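import Summits.CriticalPhenomena.PercolationContinuityZ3.Theorems.Transplant.FKConnectivityAllQForestStarDescent
import HarnessLib

/-!
# STAR DESCENT, far form: red-join positivity at NON-NEIGHBOURS of `o` (node `HubPairRedJoinFarOn`, NOT asserted) ⇒ the square-free
# adjacent forest Rayleigh inequality on every top fibre

Support file (`--supports stmt-CriticalPhenomena-4575`), FK sub-lane `prim-bschramm-fk-1` (gen 27) of the post-continuity programme;
builds on p205010 (kernel theorem, internal audit signed; external expert review pending).  Two definitions (one counting predicate, one
`@[conjecture]` node — NOT asserted), no named facts, no sorries; standard axioms.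

`…ForestStarDescent` proves `adjForestNoSq_top_of_redJoin : HubPairRedJoinOn V → (node on every top fibre)`, but the unrestricted node
`HubPairRedJoinOn` (the (RJ) inequality `Σ χ(e,f)[s ∈ C_A(o)] ≥ 0` for EVERY vertex `s`) contains the node itself as the case `s = o`
(`reachEv o o` is the whole space), so that arrow is formally weak.  The descent USES (RJ) only at vertices `s ≠ o` whose pair `os` is NOT in
the fibre.  THIS FILE records the honest form: **`HubPairRedJoinFarOn V`** (the (RJ) inequality for `s ≠ o`, `s(o,s) ∉ M ∪ u₀` only) and
**`adjForestNoSq_top_of_redJoinFar : HubPairRedJoinFarOn V → (node on every top fibre (Eg, ∅))`**, same induction (base: g22's cone theorem /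
g18's cut-vertex equality via `adjForestNoSq_top_of_universal`; step: `adjForestNoSq_fibre_of_insert_star`).  Evidence for (RJ-far): fk-1 g26's
literal table (all connected graphs ≤ 9 vertices; the `A+(z)` row), g27: 0 / 70,932,120 labelled cells with `s ∉ N[o]` at `n = 7` (rj_all.c),
0 / 1,487 random instances with 5–20 vertices (transfer-matrix engine); memo bschramm/FROM-fk-1-g27-CLUSTER-REPULSION.md §3, §5.
[cite: SempleWelsh2008, Conj. 1.1 (p. 2); Thm. 4.2 (p. 11)] [cite: Linusson2011, Prop. 2.6] [cite: Grimmett2006, §1.5 (p. 13)]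
-/

noncomputable section

namespace Summit.CriticalPhenomena.PercolationContinuityZ3.Theorems
namespace FK

open MeasureTheory Set Literature.Probability.LatticeModels Literature.Probability.Percolation
open scoped Classical symmDiff

variable {V : Type*} [Fintype V]

/-! ### The FAR form of (RJ): only non-neighbours `s ≠ o` are needed -/

section Far

/-- **FAR RED-JOIN POSITIVITY (RJ-far) on the vertex type `V`**: the (RJ) inequality restricted to vertices `s ≠ o` NOT joined to `o`
by a pair of the fibre (`s(o, s) ∉ M ∪ u₀`) — the only instances the star descent uses.  (The unrestricted `HubPairRedJoinOn` contains
the node itself as its case `s = o`, since `reachEv o o` is everything; this far form does not.)  CONJECTURE-SHAPED COUNTING STATEMENT, NOT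
asserted; evidence: fk-1 g26's literal table (all graphs ≤ 9 vertices), g27: 0 / 70,932,120 labelled cells at n = 7, 0 / 1,487 random instances
n ≤ 20. [cite: SempleWelsh2008, Conj. 1.1 (p. 2)] [cite: Linusson2011, Prop. 2.6] -/
def HubPairRedJoinFarOn (V : Type*) [Fintype V] : Prop :=
  ∀ (M u₀ : BondConfig V), Disjoint u₀ M → ∀ (o v y s : V), v ≠ y → s ≠ o → s(o, s) ∉ M → s(o, s) ∉ u₀ →
    fibreCount M u₀ (forestEv V ∩ {ω | s(o, v) ∈ ω ∧ s(o, y) ∈ ω} ∩ reachEv o s) (forestEv V) +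
        fibreCount M u₀ (forestEv V ∩ reachEv o s) (forestEv V ∩ {ω | s(o, v) ∈ ω ∧ s(o, y) ∈ ω}) ≤
      fibreCount M u₀ (forestEv V ∩ {ω | s(o, v) ∈ ω} ∩ reachEv o s) (forestEv V ∩ {ω | s(o, y) ∈ ω}) +
        fibreCount M u₀ (forestEv V ∩ {ω | s(o, y) ∈ ω} ∩ reachEv o s) (forestEv V ∩ {ω | s(o, v) ∈ ω})

/-- **Far red-join positivity on every finite vertex type.**  CONJECTURE-SHAPED, NOT asserted. [cite: SempleWelsh2008, Conj. 1.1 (p. 2)] -/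
@[conjecture] def HubPairRedJoinFarPos : Prop := ∀ n : ℕ, HubPairRedJoinFarOn (Fin n)

/-- The unrestricted form implies the far form. [cite: Linusson2011, Prop. 2.6] -/
theorem hubPairRedJoinFarOn_of_redJoinOn (h : HubPairRedJoinOn V) : HubPairRedJoinFarOn V :=
  fun M u₀ hd o v y s hvy _ _ _ => h M u₀ hd o v y s hvy

/-- **FAR RED-JOIN POSITIVITY ⇒ THE NODE ON EVERY TOP FIBRE** (the non-trivial form of the star descent: the hypothesis is used only at
vertices `s` not yet joined to `o`, descending from the cone where the node is g22's theorem / g18's cut-vertex equality).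
[cite: SempleWelsh2008, Conj. 1.1 (p. 2); Thm. 4.2 (p. 11)] [cite: Linusson2011, Prop. 2.6] [cite: Grimmett2006, §1.5 (p. 13)] -/
theorem adjForestNoSq_top_of_redJoinFar (h : HubPairRedJoinFarOn V) (Eg : BondConfig V) (o : V) {v y : V} (hvy : v ≠ y) :
    fibreCount Eg ∅ (forestEv V ∩ {ω | s(o, v) ∈ ω ∧ s(o, y) ∈ ω}) (forestEv V) ≤
      fibreCount Eg ∅ (forestEv V ∩ {ω | s(o, v) ∈ ω}) (forestEv V ∩ {ω | s(o, y) ∈ ω}) := by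
  -- degenerate placements
  by_cases hov : o = v
  · subst hov
    rw [fibreCount_eq_zero_of_forall _ _ _ _ fun ω _ hA _ => hA.1.1 _ hA.2.1 (Sym2.mk_isDiag_iff.2 rfl)]
    exact Nat.zero_le _
  by_cases hoy : o = y
  · subst hoy
    rw [fibreCount_eq_zero_of_forall _ _ _ _ fun ω _ hA _ => hA.1.1 _ hA.2.2 (Sym2.mk_isDiag_iff.2 rfl)]
    exact Nat.zero_le _
  by_cases he : s(o, v) ∈ Eg
  swap
  · rw [adjForestNoSq_bad_eq_zero_of_notMem he (notMem_empty _)]; exact Nat.zero_le _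
  by_cases hf : s(o, y) ∈ Eg
  swap
  · rw [adjForestNoSq_bad_eq_zero_of_notMem' hf (notMem_empty _)]; exact Nat.zero_le _
  -- induction on the number of non-neighbours of `o`
  suffices H : ∀ (k : ℕ) (E : BondConfig V), s(o, v) ∈ E → s(o, y) ∈ E →
      ({w : V | w ≠ o ∧ s(o, w) ∉ E} : Set V).ncard = k →
      fibreCount E ∅ (forestEv V ∩ {ω | s(o, v) ∈ ω ∧ s(o, y) ∈ ω}) (forestEv V) ≤
        fibreCount E ∅ (forestEv V ∩ {ω | s(o, v) ∈ ω}) (forestEv V ∩ {ω | s(o, y) ∈ ω}) from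
    H _ Eg he hf rfl
  intro k
  induction k with
  | zero =>
    intro E heE hfE hk
    refine adjForestNoSq_top_of_universal (fun w hw => ?_) hvy hov hoy
    by_contra hnot
    have hmem : w ∈ ({w : V | w ≠ o ∧ s(o, w) ∉ E} : Set V) := ⟨hw, hnot⟩
    rw [(Set.ncard_eq_zero (Set.toFinite _)).1 hk] at hmem
    exact hmem
  | succ k ih =>
    intro E heE hfE hk
    obtain ⟨s, hso, hsE⟩ : ({w : V | w ≠ o ∧ s(o, w) ∉ E} : Set V).Nonempty :=
      Set.nonempty_of_ncard_ne_zero (by rw [hk]; exact Nat.succ_ne_zero k)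
    have hsv : s ≠ v := fun h' => hsE (h' ▸ heE)
    have hsy : s ≠ y := fun h' => hsE (h' ▸ hfE)
    have hcard : ({w : V | w ≠ o ∧ s(o, w) ∉ insert s(o, s) E} : Set V).ncard = k := by
      have hsub : ({w : V | w ≠ o ∧ s(o, w) ∉ insert s(o, s) E} : Set V) = {w : V | w ≠ o ∧ s(o, w) ∉ E} \ {s} := by
        ext w
        simp only [mem_setOf_eq, mem_sdiff, mem_singleton_iff, mem_insert_iff, not_or]
        constructor
        · rintro ⟨hwo, hws, hwE⟩
          exact ⟨⟨hwo, hwE⟩, fun hws' => hws (by rw [hws'])⟩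
        · rintro ⟨⟨hwo, hwE⟩, hws⟩
          exact ⟨hwo, fun h' => hws (Sym2.congr_right.1 h'), hwE⟩
      rw [hsub, Set.ncard_sdiff_singleton_of_mem (show s ∈ ({w : V | w ≠ o ∧ s(o, w) ∉ E} : Set V) from ⟨hso, hsE⟩), hk]
      rfl
    have hup := ih (insert s(o, s) E) (mem_insert_of_mem _ heE) (mem_insert_of_mem _ hfE) hcard
    exact adjForestNoSq_fibre_of_insert_star hso.symm hsv hsy hsE (notMem_empty _)
      (h E ∅ (Set.empty_disjoint _) o v y s hvy hso hsE (notMem_empty _)) hup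

/-- **`HubPairRedJoinFarPos` ⇒ the node on every top fibre of every `Fin n`.** [cite: SempleWelsh2008, Conj. 1.1 (p. 2)] -/
theorem adjForestNoSq_top_of_redJoinFarPos (h : HubPairRedJoinFarPos) (n : ℕ) (Eg : BondConfig (Fin n)) (o : Fin n) {v y : Fin n}
    (hvy : v ≠ y) :
    fibreCount Eg ∅ (forestEv (Fin n) ∩ {ω | s(o, v) ∈ ω ∧ s(o, y) ∈ ω}) (forestEv (Fin n)) ≤
      fibreCount Eg ∅ (forestEv (Fin n) ∩ {ω | s(o, v) ∈ ω}) (forestEv (Fin n) ∩ {ω | s(o, y) ∈ ω}) :=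
  adjForestNoSq_top_of_redJoinFar (h n) Eg o hvy

end Far

end FK
end Summit.CriticalPhenomena.PercolationContinuityZ3.Theorems

end
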